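import Literature.IUT.LogVolume.GenuineLogThetaExactVolume
import Literature.IUT.LogVolume.TensorPacketSlotContent
import HarnessLib

/-!
# The EXACT value of `−|log(Θ)|_p` in the PER-IMAGE reading (P), and reading (U) minus reading (P) at a real prime
# packet: the slot defect up to `± log p` ([IUTchIII] Cor. 3.12 Step (x); [IUTchIV] Thm. 1.10 Step (v); Dupuy–Hilado §4.9–4.12)

Proof-only file of the abc-iut cell (R2 S-chain seat abc-iut-s2-p2), part 2 of 3 (part 1: `TensorPacketSlotContent.lean`,
part 3: `GenuineLogThetaUnionPerImageResidue.lean`); sequel to abc-iut-c312-3's `GenuineLogThetaExactVolume.lean` and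
abc-iut-S7's `GenuineLogThetaPerImage.lean`. TAKES NO SIDE on [IUTchIII] Cor. 3.12 or on which reading print's `−|log(Θ)|`
is. S. Mochizuki, *IUT III* [Mochizuki2012] Cor. 3.12 (kurims p. 174, reading (U): hull of the UNION of the possible
images — `PrimePacket.negLogThetaAt`) and its proof Step (x) (p. 181: «the resulting log-volumes … one for each possible
image», reading (P) — `PrimePacket.negLogThetaPerImageAt`); *IUT IV* Thm. 1.10 Step (v) (kurims p. 27–28); Dupuy–Hilado,
arXiv:2004.13228 [DupuyHilado2025] §3.9, §4.7, §4.9, §4.11–4.12; A. Weil [WeilBNT1967] Ch. II §2 Th. 2.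

At a summand `v⃗ = e` of degree `j = i+1 ≤ ℓ⋆` of the real packet `realPrimePacketWith p 𝔽 c` (any shell), reading (P)
takes the hull of the (Ind2)-orbit of the ONE region `M_P = ι_j(t_{i,v_j})·(R_I)^∼`, reading (U) that of the slot union
`M_U = ⋃_a ι_a(t_{i,v_a})·(R_I)^∼` (c312-3 `realPrimePacketWith_possibleImages_pilotRegion_eq`). By abc-iut-w5-d180's
orbit-content algebra both hulls are `hull(p^m·log_p(R_I^×))` for the respective contents, with log-volume
`−m·log p + log μ̄(hull(log_p(R_I^×)))` — the SAME lattice constant. This file proves: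

* `realPrimePacketWith_slotImages_pilotRegion_eq`, `realPrimePacketWith_exists_content_logμ_slotImagesHull`,
  **`realPrimePacketWith_negLogThetaPerImageAt_eq_of_content`** — the EXACT per-image formula
  `−|log(Θ)|^{(P)}_p = (1/ℓ⋆)·Σ_i Σ_{v⃗} (−m_P(i,v⃗)·log p + log μ̄(hull(log_p(R_{v⃗}^×))))·Π_b Pr(v_b)` (twin of c312-3's
  `realPrimePacketWith_negLogThetaAt_eq_of_content`);
* **`realPrimePacketWith_logμ_possibleImagesHull_sub_slotImagesHull`** — per summand, for any bookkeeping `θ` with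
  `log‖t_{i,v}‖ = −θ_i(v)`: `θ_i(v_j) − min_a θ_i(v_a) − log p ≤ log μ̄(hull_U)_{v⃗} − log μ̄(hull_P)_{v⃗} ≤ θ_i(v_j) − min_a θ_i(v_a) + log p`
  (part 1's content comparison), `…_eq_…_of_const` (equality at a slot-constant collection);
* **`realPrimePacketWith_negLogThetaAt_perImage_two_sided`** — summed with Dupuy–Hilado's weights:
  `−|log(Θ)|^{(P)}_p + R_p(θ) − log p ≤ −|log(Θ)|_p ≤ −|log(Θ)|^{(P)}_p + R_p(θ) + log p`,
  `R_p(θ) = (1/ℓ⋆)Σ_iΣ_{v⃗}(θ_i(v_j) − min_a θ_i(v_a))·Π Pr` (the `p`-part of abc-iut-S8's `PilotData.slotResidue` when `θ` =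
  the slot values); `realPrimePacketWith_negLogThetaAt_eq_perImage_of_const`.
[cite: Mochizuki2012, IUTchIII Cor. 3.12 p. 174; proof Step (x) p. 181] [cite: Mochizuki2012, IUTchIV Thm. 1.10 Step (v) p. 27–28]
[cite: DupuyHilado2025, §3.9, §4.7, §4.9, §4.11, §4.12] [cite: WeilBNT1967, Ch. II §2, Th. 2] [claim: Mochizuki2012, status: disputed]
for every IUT quotation. PROOF-ONLY: no definitions; (Ind1)/(Ind2)/hull are the tree's typings of disputed-corpus
constructions; typed ≠ proved.
-/

noncomputable section

open Set Module NumberField IsDedekindDomain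
open scoped Pointwise TensorProduct

namespace Literature.IUT.LogVolume

/-! ## Packet level: the real packet over a family of local fields (any shell normalisation) -/

section RealPacketWith

variable {F : Type} [Field F] [NumberField F]
variable (p : ℕ) [Fact p.Prime] (𝔽 : LocalFields F p)
variable (c : (j : ℕ) → (Fin (j + 1) → placesOver F p) → ℚ_[p]) (hc0 : ∀ j e, c j e ≠ 0)
  (hcσ : ∀ (j : ℕ) (σ : Equiv.Perm (Fin (j + 1))) (e : Fin (j + 1) → placesOver F p), c j (e ∘ σ) = c j e)

/-- **The slot images of the sharp datum at a summand are the (Ind2)-orbit of the LAST-slot twist**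
`⋃_g g·(ι_j(t_{i,v_j})·(R_I)^∼)` (degree `j = i+1 ≤ ℓ⋆`, collection `v⃗ = e`). [cite: DupuyHilado2025, §3.9, §4.9] -/
theorem realPrimePacketWith_slotImages_pilotRegion_eq {lstar : ℕ}
    (t : Fin lstar → (v : placesOver F p) → (𝔽.k v)ˣ) (i : Fin lstar)
    (e : Fin ((i : ℕ) + 1 + 1) → placesOver F p) :
    (realPrimePacketWith p 𝔽 c hc0 hcσ).slotImages
        ((realPrimePacketWith p 𝔽 c hc0 hcσ).pilotRegion t) ((i : ℕ) + 1) e =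
      ⋃ g : indTwo p (fun b => 𝔽.k (e b)),
        g • (iota p (fun b => 𝔽.k (e b)) (Fin.last _) (t i (e (Fin.last _)) : 𝔽.k (e (Fin.last _))) •
          (normalizedPacket p (fun b => 𝔽.k (e b)) : Set (PacketAlgebra p (fun b => 𝔽.k (e b))))) := by
  unfold PrimePacket.slotImages
  rw [PrimePacket.pilotRegion_succ_eq, realPrimePacketWith_peel_image', realPrimePacketWith_O']
  rfl

/-- The last-slot twist contains the nonzero vector `ι_j(t_{i,v_j})`. [cite: DupuyHilado2025, §3.7] -/
theorem exists_ne_zero_mem_lastSlot {lstar : ℕ} (t : Fin lstar → (v : placesOver F p) → (𝔽.k v)ˣ)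
    (i : Fin lstar) (e : Fin ((i : ℕ) + 1 + 1) → placesOver F p) :
    ∃ x ∈ iota p (fun b => 𝔽.k (e b)) (Fin.last _) (t i (e (Fin.last _)) : 𝔽.k (e (Fin.last _))) •
        (normalizedPacket p (fun b => 𝔽.k (e b)) : Set (PacketAlgebra p (fun b => 𝔽.k (e b)))), x ≠ 0 := by
  refine ⟨iota p (fun b => 𝔽.k (e b)) (Fin.last _) (t i (e (Fin.last _)) : 𝔽.k (e (Fin.last _))), ?_, ?_⟩
  · have h := Set.smul_mem_smul_set (a := iota p (fun b => 𝔽.k (e b)) (Fin.last _)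
      (t i (e (Fin.last _)) : 𝔽.k (e (Fin.last _))))
      (Subring.one_mem (normalizedPacket p (fun b => 𝔽.k (e b))) : (1 : PacketAlgebra p (fun b => 𝔽.k (e b))) ∈
        (normalizedPacket p (fun b => 𝔽.k (e b)) : Set (PacketAlgebra p (fun b => 𝔽.k (e b)))))
    rwa [smul_eq_mul, mul_one] at h
  · exact (map_ne_zero (iota p (fun b => 𝔽.k (e b)) (Fin.last _))).mpr (t i (e (Fin.last _))).ne_zero

/-- **The per-image Θ-hull at a summand and its EXACT log-volume**: there is an integer `m` — the content of the
last-slot twist `M_P = ι_j(t_{i,v_j})·(R_I)^∼` w.r.t. `log_p(R_I^×)` — with `hull(slot images)_{v⃗} = hull(p^m·log_p(R_I^×))`,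
admissible, of log-volume `−m·log p + log μ̄(hull(log_p(R_I^×)))` (abc-iut-w5-d180's orbit-content algebra applied to the
single region `M_P`; twin of c312-3's union statement). [cite: DupuyHilado2025, §4.9, §4.12] [cite: WeilBNT1967, Ch. II §2, Th. 2] -/
theorem realPrimePacketWith_exists_content_logμ_slotImagesHull {lstar : ℕ}
    (t : Fin lstar → (v : placesOver F p) → (𝔽.k v)ˣ) (i : Fin lstar)
    (e : Fin ((i : ℕ) + 1 + 1) → placesOver F p) :
    ∃ m : ℤ,
      iota p (fun b => 𝔽.k (e b)) (Fin.last _) (t i (e (Fin.last _)) : 𝔽.k (e (Fin.last _))) •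
          (normalizedPacket p (fun b => 𝔽.k (e b)) : Set (PacketAlgebra p (fun b => 𝔽.k (e b)))) ⊆
        ((p : ℚ_[p]) ^ m) • (logPacket p (fun b => 𝔽.k (e b)) : Set (PacketAlgebra p (fun b => 𝔽.k (e b)))) ∧
      ¬ iota p (fun b => 𝔽.k (e b)) (Fin.last _) (t i (e (Fin.last _)) : 𝔽.k (e (Fin.last _))) •
          (normalizedPacket p (fun b => 𝔽.k (e b)) : Set (PacketAlgebra p (fun b => 𝔽.k (e b)))) ⊆
        ((p : ℚ_[p]) ^ (m + 1)) • (logPacket p (fun b => 𝔽.k (e b)) : Set (PacketAlgebra p (fun b => 𝔽.k (e b)))) ∧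
      (realPrimePacketWith p 𝔽 c hc0 hcσ).slotImagesHull
          ((realPrimePacketWith p 𝔽 c hc0 hcσ).pilotRegion t) ((i : ℕ) + 1) e =
        packetHull p (fun b => 𝔽.k (e b)) (((p : ℚ_[p]) ^ m) •
          (logPacket p (fun b => 𝔽.k (e b)) : Set (PacketAlgebra p (fun b => 𝔽.k (e b))))) ∧
      (realPrimePacketWith p 𝔽 c hc0 hcσ).adm ((realPrimePacketWith p 𝔽 c hc0 hcσ).slotImagesHull
          ((realPrimePacketWith p 𝔽 c hc0 hcσ).pilotRegion t) ((i : ℕ) + 1) e) ∧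
      (realPrimePacketWith p 𝔽 c hc0 hcσ).logμ ((realPrimePacketWith p 𝔽 c hc0 hcσ).slotImagesHull
          ((realPrimePacketWith p 𝔽 c hc0 hcσ).pilotRegion t) ((i : ℕ) + 1) e) =
        -(m * Real.log p) + packetLogμ p (fun b => 𝔽.k (e b))
          (packetHull p (fun b => 𝔽.k (e b))
            (logPacket p (fun b => 𝔽.k (e b)) : Set (PacketAlgebra p (fun b => 𝔽.k (e b))))) := by
  obtain ⟨m, hm, hm1⟩ := exists_content p (fun b => 𝔽.k (e b))
    (isPsiBounded_smul_normalizedPacket p (fun b => 𝔽.k (e b)) _) (exists_ne_zero_mem_lastSlot p 𝔽 t i e)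
  obtain ⟨x, hxM, hx⟩ := Set.not_subset.mp hm1
  have hhull : (realPrimePacketWith p 𝔽 c hc0 hcσ).slotImagesHull
      ((realPrimePacketWith p 𝔽 c hc0 hcσ).pilotRegion t) ((i : ℕ) + 1) e =
        packetHull p (fun b => 𝔽.k (e b)) (((p : ℚ_[p]) ^ m) •
          (logPacket p (fun b => 𝔽.k (e b)) : Set (PacketAlgebra p (fun b => 𝔽.k (e b))))) := by
    change packetHull p (fun b => 𝔽.k (e b)) ((realPrimePacketWith p 𝔽 c hc0 hcσ).slotImages
      ((realPrimePacketWith p 𝔽 c hc0 hcσ).pilotRegion t) ((i : ℕ) + 1) e) = _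
    rw [realPrimePacketWith_slotImages_pilotRegion_eq]
    exact packetHull_orbit_eq_zpow p (fun b => 𝔽.k (e b)) hxM hx hm
  refine ⟨m, hm, hm1, hhull, ?_, ?_⟩
  · rw [hhull]
    exact packetAdm_packetHull_zpow_smul_logPacket p (fun b => 𝔽.k (e b)) m
  · rw [hhull]
    exact packetLogμ_packetHull_zpow_smul_logPacket p (fun b => 𝔽.k (e b)) m

/-- **`−|log(Θ)|^{(P)}_p` in terms of ANY family of last-slot contents**: if `m(i,v⃗)` is the content of
`ι_j(t_{i,v_j})·(R_I)^∼` at every summand, then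
`−|log(Θ)|^{(P)}_p = (1/ℓ⋆)·Σ_i Σ_{v⃗} (−m(i,v⃗)·log p + log μ̄(hull(log_p(R_{v⃗}^×))))·Π_b Pr(v_b)` — the per-image twin of
c312-3's `realPrimePacketWith_negLogThetaAt_eq_of_content`, with the SAME lattice constant.
[cite: Mochizuki2012, IUTchIII Cor. 3.12 proof Step (x) p. 181] [cite: DupuyHilado2025, Def. 3.6.3, §4.12] -/
theorem realPrimePacketWith_negLogThetaPerImageAt_eq_of_content {lstar : ℕ}
    (t : Fin lstar → (v : placesOver F p) → (𝔽.k v)ˣ)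
    (m : (i : Fin lstar) → (Fin ((i : ℕ) + 1 + 1) → placesOver F p) → ℤ)
    (hm : ∀ (i : Fin lstar) (e : Fin ((i : ℕ) + 1 + 1) → placesOver F p),
      iota p (fun b => 𝔽.k (e b)) (Fin.last _) (t i (e (Fin.last _)) : 𝔽.k (e (Fin.last _))) •
          (normalizedPacket p (fun b => 𝔽.k (e b)) : Set (PacketAlgebra p (fun b => 𝔽.k (e b)))) ⊆
        ((p : ℚ_[p]) ^ m i e) • (logPacket p (fun b => 𝔽.k (e b)) : Set (PacketAlgebra p (fun b => 𝔽.k (e b)))) ∧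
      ¬ iota p (fun b => 𝔽.k (e b)) (Fin.last _) (t i (e (Fin.last _)) : 𝔽.k (e (Fin.last _))) •
          (normalizedPacket p (fun b => 𝔽.k (e b)) : Set (PacketAlgebra p (fun b => 𝔽.k (e b)))) ⊆
        ((p : ℚ_[p]) ^ (m i e + 1)) •
          (logPacket p (fun b => 𝔽.k (e b)) : Set (PacketAlgebra p (fun b => 𝔽.k (e b))))) :
    (realPrimePacketWith p 𝔽 c hc0 hcσ).negLogThetaPerImageAt lstar t =
      (1 / (lstar : ℝ)) * ∑ i : Fin lstar, ∑ e : Fin ((i : ℕ) + 1 + 1) → placesOver F p,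
        (-(m i e * Real.log p) + packetLogμ p (fun b => 𝔽.k (e b))
          (packetHull p (fun b => 𝔽.k (e b))
            (logPacket p (fun b => 𝔽.k (e b)) : Set (PacketAlgebra p (fun b => 𝔽.k (e b)))))) *
          ∏ b, weight F (e b).1 := by
  unfold PrimePacket.negLogThetaPerImageAt PrimePacket.lnνLp PrimePacket.lnνTensorPower
  refine congrArg (fun x : ℝ => (1 / (lstar : ℝ)) * x) (Finset.sum_congr rfl fun i _ => ?_)
  refine Finset.sum_congr rfl fun e _ => ?_
  obtain ⟨m', hm', hm1', -, -, hvol⟩ :=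
    realPrimePacketWith_exists_content_logμ_slotImagesHull p 𝔽 c hc0 hcσ t i e
  have hmm : m' = m i e := content_unique p (fun b => 𝔽.k (e b)) hm' hm1' (hm i e).1 (hm i e).2
  rw [hvol, hmm]

/-- **Per summand: reading (U) minus reading (P) equals the slot defect up to `± log p`.** For any bookkeeping
`θ` of the idele norms (`log‖t_{i,v}‖ = −θ_i(v)`), at every summand `v⃗ = e` of degree `j = i+1`:
`θ_i(v_j) − min_a θ_i(v_a) − log p ≤ log μ̄(hull_U)_{v⃗} − log μ̄(hull_P)_{v⃗} ≤ θ_i(v_j) − min_a θ_i(v_a) + log p`.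
[cite: Mochizuki2012, IUTchIV Thm. 1.10 Step (v) p. 27–28] [cite: DupuyHilado2025, §4.7, §4.9, §4.12] -/
theorem realPrimePacketWith_logμ_possibleImagesHull_sub_slotImagesHull {lstar : ℕ}
    (t : Fin lstar → (v : placesOver F p) → (𝔽.k v)ˣ) (θ : Fin lstar → placesOver F p → ℝ)
    (hθ : ∀ i v, Real.log ‖(t i v : 𝔽.k v)‖ = -θ i v) (i : Fin lstar)
    (e : Fin ((i : ℕ) + 1 + 1) → placesOver F p) :
    θ i (e (Fin.last _)) - Finset.univ.inf' Finset.univ_nonempty (fun a => θ i (e a)) - Real.log p ≤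
      (realPrimePacketWith p 𝔽 c hc0 hcσ).logμ ((realPrimePacketWith p 𝔽 c hc0 hcσ).possibleImagesHull
          ((realPrimePacketWith p 𝔽 c hc0 hcσ).pilotRegion t) ((i : ℕ) + 1) e) -
        (realPrimePacketWith p 𝔽 c hc0 hcσ).logμ ((realPrimePacketWith p 𝔽 c hc0 hcσ).slotImagesHull
          ((realPrimePacketWith p 𝔽 c hc0 hcσ).pilotRegion t) ((i : ℕ) + 1) e) ∧
    (realPrimePacketWith p 𝔽 c hc0 hcσ).logμ ((realPrimePacketWith p 𝔽 c hc0 hcσ).possibleImagesHull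
          ((realPrimePacketWith p 𝔽 c hc0 hcσ).pilotRegion t) ((i : ℕ) + 1) e) -
        (realPrimePacketWith p 𝔽 c hc0 hcσ).logμ ((realPrimePacketWith p 𝔽 c hc0 hcσ).slotImagesHull
          ((realPrimePacketWith p 𝔽 c hc0 hcσ).pilotRegion t) ((i : ℕ) + 1) e) ≤
      θ i (e (Fin.last _)) - Finset.univ.inf' Finset.univ_nonempty (fun a => θ i (e a)) + Real.log p := by
  obtain ⟨mU, hU, hU1, -, -, hvolU⟩ :=
    realPrimePacketWith_exists_content_logμ_possibleImagesHull p 𝔽 c hc0 hcσ t i e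
  obtain ⟨mP, hP, hP1, -, -, hvolP⟩ :=
    realPrimePacketWith_exists_content_logμ_slotImagesHull p 𝔽 c hc0 hcσ t i e
  rw [hvolU, hvolP]
  have hdiff : -(mU * Real.log p) + packetLogμ p (fun b => 𝔽.k (e b))
        (packetHull p (fun b => 𝔽.k (e b))
          (logPacket p (fun b => 𝔽.k (e b)) : Set (PacketAlgebra p (fun b => 𝔽.k (e b))))) -
      (-(mP * Real.log p) + packetLogμ p (fun b => 𝔽.k (e b))
        (packetHull p (fun b => 𝔽.k (e b))
          (logPacket p (fun b => 𝔽.k (e b)) : Set (PacketAlgebra p (fun b => 𝔽.k (e b)))))) =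
      ((mP - mU : ℤ) : ℝ) * Real.log p := by push_cast; ring
  rw [hdiff]
  -- the idele norms at the slots
  set q : (a : Fin ((i : ℕ) + 1 + 1)) → 𝔽.k (e a) := fun a => (t i (e a) : 𝔽.k (e a)) with hq
  have hq0 : ∀ a, q a ≠ 0 := fun a => (t i (e a)).ne_zero
  have hlog : ∀ a, Real.log ‖q a‖ = -θ i (e a) := fun a => hθ i (e a)
  -- the least divisible slot
  obtain ⟨a₀, -, ha₀⟩ := Finset.exists_mem_eq_inf' Finset.univ_nonempty (fun a => θ i (e a))
  have hmax : ∀ a, ‖q a‖ ≤ ‖q a₀‖ := fun a => by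
    rw [← Real.log_le_log_iff (norm_pos_iff.mpr (hq0 a)) (norm_pos_iff.mpr (hq0 a₀)), hlog, hlog, neg_le_neg_iff,
      ← ha₀]
    exact Finset.inf'_le _ (Finset.mem_univ a)
  constructor
  · have h := content_lastSlot_sub_slotUnion_ge p (fun b => 𝔽.k (e b)) q hq0 (Fin.last _) hU hP1 a₀
    rw [hlog, hlog, ← ha₀] at h
    linarith
  · have h := content_lastSlot_sub_slotUnion_le p (fun b => 𝔽.k (e b)) q hq0 (Fin.last _) a₀ hmax hU1 hP
    rw [hlog, hlog, ← ha₀] at h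
    linarith

/-- **Per summand, slot-constant ⇒ no difference**: if `θ_i` is constant on the collection, the two hulls have the same
log-volume. [cite: Mochizuki2012, IUTchIV Thm. 1.10 Step (v) p. 28] [cite: DupuyHilado2025, §4.7] -/
theorem realPrimePacketWith_logμ_possibleImagesHull_eq_slotImagesHull_of_const {lstar : ℕ}
    (t : Fin lstar → (v : placesOver F p) → (𝔽.k v)ˣ) (θ : Fin lstar → placesOver F p → ℝ)
    (hθ : ∀ i v, Real.log ‖(t i v : 𝔽.k v)‖ = -θ i v) (i : Fin lstar)
    (e : Fin ((i : ℕ) + 1 + 1) → placesOver F p) (hconst : ∀ a, θ i (e a) = θ i (e (Fin.last _))) :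
    (realPrimePacketWith p 𝔽 c hc0 hcσ).logμ ((realPrimePacketWith p 𝔽 c hc0 hcσ).possibleImagesHull
          ((realPrimePacketWith p 𝔽 c hc0 hcσ).pilotRegion t) ((i : ℕ) + 1) e) =
      (realPrimePacketWith p 𝔽 c hc0 hcσ).logμ ((realPrimePacketWith p 𝔽 c hc0 hcσ).slotImagesHull
          ((realPrimePacketWith p 𝔽 c hc0 hcσ).pilotRegion t) ((i : ℕ) + 1) e) := by
  obtain ⟨mU, hU, hU1, -, -, hvolU⟩ :=
    realPrimePacketWith_exists_content_logμ_possibleImagesHull p 𝔽 c hc0 hcσ t i e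
  obtain ⟨mP, hP, hP1, -, -, hvolP⟩ :=
    realPrimePacketWith_exists_content_logμ_slotImagesHull p 𝔽 c hc0 hcσ t i e
  rw [hvolU, hvolP]
  have hq0 : ∀ a : Fin ((i : ℕ) + 1 + 1), (t i (e a) : 𝔽.k (e a)) ≠ 0 := fun a => (t i (e a)).ne_zero
  have hnorm : ∀ a : Fin ((i : ℕ) + 1 + 1), ‖(t i (e a) : 𝔽.k (e a))‖ = ‖(t i (e (Fin.last _)) : 𝔽.k (e (Fin.last _)))‖ := by
    intro a
    have h1 : Real.log ‖(t i (e a) : 𝔽.k (e a))‖ = Real.log ‖(t i (e (Fin.last _)) : 𝔽.k (e (Fin.last _)))‖ := by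
      rw [hθ, hθ, hconst a]
    exact Real.log_injOn_pos (Set.mem_Ioi.mpr (norm_pos_iff.mpr (hq0 a)))
      (Set.mem_Ioi.mpr (norm_pos_iff.mpr (hq0 _))) h1
  have hmm : mP = mU := content_lastSlot_eq_slotUnion_of_norm_eq p (fun b => 𝔽.k (e b))
    (fun a => (t i (e a) : 𝔽.k (e a))) hq0 (Fin.last _) hnorm hU hU1 hP hP1
  rw [hmm]

/-- The product weights of the collections over a prime sum to `1`. [cite: DupuyHilado2025, §3.6] -/
theorem sum_prod_weight_eq_one (n : ℕ) :
    ∑ e : Fin n → placesOver F p, ∏ b, weight F (e b).1 = 1 := by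
  have h : ∑ v : placesOver F p, weight F v.1 = 1 := (localWeights F p).sum_pr
  rw [← Fintype.sum_pow (f := fun v : placesOver F p => weight F v.1) n, h, one_pow]

/-- **Packet level, two-sided**: for any bookkeeping `θ` of the idele norms,
`−|log(Θ)|^{(P)}_p + (1/ℓ⋆)Σ_iΣ_{v⃗}(θ_i(v_j) − min_a θ_i(v_a))·Π Pr − log p ≤ −|log(Θ)|_p
 ≤ −|log(Θ)|^{(P)}_p + (1/ℓ⋆)Σ_iΣ_{v⃗}(θ_i(v_j) − min_a θ_i(v_a))·Π Pr + log p` (`ℓ⋆ ≥ 1`).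
[cite: Mochizuki2012, IUTchIII Cor. 3.12 p. 174; proof Step (x) p. 181] [cite: DupuyHilado2025, Def. 3.6.3, §4.7, §4.12] -/
theorem realPrimePacketWith_negLogThetaAt_perImage_two_sided {lstar : ℕ} (hl : 0 < lstar)
    (t : Fin lstar → (v : placesOver F p) → (𝔽.k v)ˣ) (θ : Fin lstar → placesOver F p → ℝ)
    (hθ : ∀ i v, Real.log ‖(t i v : 𝔽.k v)‖ = -θ i v) :
    (realPrimePacketWith p 𝔽 c hc0 hcσ).negLogThetaPerImageAt lstar t +
        (1 / (lstar : ℝ)) * ∑ i : Fin lstar, ∑ e : Fin ((i : ℕ) + 1 + 1) → placesOver F p,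
          (θ i (e (Fin.last _)) - Finset.univ.inf' Finset.univ_nonempty (fun a => θ i (e a))) *
            ∏ b, weight F (e b).1 - Real.log p ≤
      (realPrimePacketWith p 𝔽 c hc0 hcσ).negLogThetaAt lstar t ∧
    (realPrimePacketWith p 𝔽 c hc0 hcσ).negLogThetaAt lstar t ≤
      (realPrimePacketWith p 𝔽 c hc0 hcσ).negLogThetaPerImageAt lstar t +
        (1 / (lstar : ℝ)) * ∑ i : Fin lstar, ∑ e : Fin ((i : ℕ) + 1 + 1) → placesOver F p,
          (θ i (e (Fin.last _)) - Finset.univ.inf' Finset.univ_nonempty (fun a => θ i (e a))) *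
            ∏ b, weight F (e b).1 + Real.log p := by
  -- write `± log p` as the average of `± log p` over the procession and the collections
  have hl0 : (lstar : ℝ) ≠ 0 := by exact_mod_cast hl.ne'
  have havg : ∀ s : ℝ, (1 / (lstar : ℝ)) * ∑ i : Fin lstar, ∑ e : Fin ((i : ℕ) + 1 + 1) → placesOver F p,
      s * ∏ b, weight F (e b).1 = s := by
    intro s
    have h1 : ∀ i : Fin lstar, ∑ e : Fin ((i : ℕ) + 1 + 1) → placesOver F p, s * ∏ b, weight F (e b).1 = s := by
      intro i
      rw [← Finset.mul_sum, sum_prod_weight_eq_one p ((i : ℕ) + 1 + 1), mul_one]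
    simp only [h1, Finset.sum_const, Finset.card_univ, Fintype.card_fin, nsmul_eq_mul]
    field_simp
  set Q := realPrimePacketWith p 𝔽 c hc0 hcσ with hQ
  -- the difference of the two numbers is the weighted average of the summand differences
  have hdiff : Q.negLogThetaAt lstar t - Q.negLogThetaPerImageAt lstar t =
      (1 / (lstar : ℝ)) * ∑ i : Fin lstar, ∑ e : Fin ((i : ℕ) + 1 + 1) → placesOver F p,
        (Q.logμ (Q.possibleImagesHull (Q.pilotRegion t) ((i : ℕ) + 1) e) -
          Q.logμ (Q.slotImagesHull (Q.pilotRegion t) ((i : ℕ) + 1) e)) * ∏ b, weight F (e b).1 := by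
    unfold PrimePacket.negLogThetaAt PrimePacket.negLogThetaPerImageAt PrimePacket.lnνLp PrimePacket.lnνTensorPower
    rw [← mul_sub, ← Finset.sum_sub_distrib]
    refine congrArg (fun x : ℝ => (1 / (lstar : ℝ)) * x) (Finset.sum_congr rfl fun i _ => ?_)
    rw [← Finset.sum_sub_distrib]
    exact Finset.sum_congr rfl fun e _ => by ring
  have hlo : (1 / (lstar : ℝ)) * ∑ i : Fin lstar, ∑ e : Fin ((i : ℕ) + 1 + 1) → placesOver F p,
        (θ i (e (Fin.last _)) - Finset.univ.inf' Finset.univ_nonempty (fun a => θ i (e a)) - Real.log p) *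
          ∏ b, weight F (e b).1 ≤
      Q.negLogThetaAt lstar t - Q.negLogThetaPerImageAt lstar t := by
    rw [hdiff]
    refine mul_le_mul_of_nonneg_left (Finset.sum_le_sum fun i _ => Finset.sum_le_sum fun e _ => ?_) (by positivity)
    exact mul_le_mul_of_nonneg_right
      (realPrimePacketWith_logμ_possibleImagesHull_sub_slotImagesHull p 𝔽 c hc0 hcσ t θ hθ i e).1
      (Finset.prod_nonneg fun b _ => weight_nonneg F (e b).1)
  have hhi : Q.negLogThetaAt lstar t - Q.negLogThetaPerImageAt lstar t ≤
      (1 / (lstar : ℝ)) * ∑ i : Fin lstar, ∑ e : Fin ((i : ℕ) + 1 + 1) → placesOver F p,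
        (θ i (e (Fin.last _)) - Finset.univ.inf' Finset.univ_nonempty (fun a => θ i (e a)) + Real.log p) *
          ∏ b, weight F (e b).1 := by
    rw [hdiff]
    refine mul_le_mul_of_nonneg_left (Finset.sum_le_sum fun i _ => Finset.sum_le_sum fun e _ => ?_) (by positivity)
    exact mul_le_mul_of_nonneg_right
      (realPrimePacketWith_logμ_possibleImagesHull_sub_slotImagesHull p 𝔽 c hc0 hcσ t θ hθ i e).2
      (Finset.prod_nonneg fun b _ => weight_nonneg F (e b).1)
  -- split off the constant `log p`
  have hsplit : ∀ s : ℝ, (1 / (lstar : ℝ)) * ∑ i : Fin lstar, ∑ e : Fin ((i : ℕ) + 1 + 1) → placesOver F p,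
        (θ i (e (Fin.last _)) - Finset.univ.inf' Finset.univ_nonempty (fun a => θ i (e a)) + s) *
          ∏ b, weight F (e b).1 =
      (1 / (lstar : ℝ)) * ∑ i : Fin lstar, ∑ e : Fin ((i : ℕ) + 1 + 1) → placesOver F p,
        (θ i (e (Fin.last _)) - Finset.univ.inf' Finset.univ_nonempty (fun a => θ i (e a))) *
          ∏ b, weight F (e b).1 + s := by
    intro s
    conv_rhs => rw [← havg s]
    rw [← mul_add, ← Finset.sum_add_distrib]
    refine congrArg (fun x : ℝ => (1 / (lstar : ℝ)) * x) (Finset.sum_congr rfl fun i _ => ?_)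
    rw [← Finset.sum_add_distrib]
    exact Finset.sum_congr rfl fun e _ => by ring
  have hsplit' := hsplit (-Real.log p)
  simp only [← sub_eq_add_neg] at hsplit'
  rw [hsplit'] at hlo
  rw [hsplit] at hhi
  constructor <;> linarith

/-- **Packet level, slot-constant ⇒ the two readings agree**: if every `θ_i` is constant on `V(F)_p`,
`−|log(Θ)|_p = −|log(Θ)|^{(P)}_p`. [cite: Mochizuki2012, IUTchIV Thm. 1.10 Step (v) p. 28] [cite: DupuyHilado2025, §4.7] -/
theorem realPrimePacketWith_negLogThetaAt_eq_perImage_of_const {lstar : ℕ}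
    (t : Fin lstar → (v : placesOver F p) → (𝔽.k v)ˣ) (θ : Fin lstar → placesOver F p → ℝ)
    (hθ : ∀ i v, Real.log ‖(t i v : 𝔽.k v)‖ = -θ i v) (hconst : ∀ i (v w : placesOver F p), θ i v = θ i w) :
    (realPrimePacketWith p 𝔽 c hc0 hcσ).negLogThetaAt lstar t =
      (realPrimePacketWith p 𝔽 c hc0 hcσ).negLogThetaPerImageAt lstar t := by
  unfold PrimePacket.negLogThetaAt PrimePacket.negLogThetaPerImageAt PrimePacket.lnνLp PrimePacket.lnνTensorPower
  refine congrArg (fun x : ℝ => (1 / (lstar : ℝ)) * x) (Finset.sum_congr rfl fun i _ => ?_)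
  refine Finset.sum_congr rfl fun e _ => ?_
  rw [realPrimePacketWith_logμ_possibleImagesHull_eq_slotImagesHull_of_const p 𝔽 c hc0 hcσ t θ hθ i e
    (fun a => hconst i (e a) (e (Fin.last _)))]

end RealPacketWith

end Literature.IUT.LogVolume

end
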